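import Mathlib
import Summits.KontsevichZagierPeriods.Zeta5Search.Families.CubicalChartVIMRate
import Summits.KontsevichZagierPeriods.Zeta5Search.Families.CellularVIMExact
import Summits.KontsevichZagierPeriods.Zeta5Search.Families.BasicGrowthDuality
import Summits.KontsevichZagierPeriods.Zeta5Search.Families.BasicGrowthClasses
import HarnessLib

/-!
# ζ(5) search — the `M_{0,10}` leading coefficients grow EXACTLY like `λ₄ = 1/vimSup`: `log A(n)/n → −log vimSup`

HONEST FRAMING: systematic search; no irrationality claim unless certified.  Cell `pub-zeta5`, certifier 2 (cert-2 g10,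
2026-08-22).  Real analysis of one explicit rational function; nothing about `ζ(5)` or `ζ(7)`; no conjecture node is used;
no number of record moves (`vimSup = λ₁` is cert-1 g5's kernel theorem `Families/CellularVIMExact`).

`Families/CubicalChartVIMRate` gave `log A(n)/n → vimRate = log ⨅_u tilt(u)`, the tilt being the dual-cell Laurent polynomial
`Λ(g) = ∏_{chords} L_e(g) / ∏_{gaps} g_w` of the frame gauge (`6` at infinity) at `g = e^u` (`tilt_eq_Lam`).  Here:
* **`FSigma_eq_Lam`** — for every real configuration `z` seated in the order `vim10` (the dual cell), Brown's projective function
  `F_{vim10}(z)` (`Families/BasicGrowthProjective.FSigma`) equals `Λ(g(z))`, `g(z)` = the gaps of the Möbius image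
  `x ↦ 1/(z₆ − x)` that sends the point `6` (0-based `5`) to infinity — and conversely every `g > 0` arises (`exists_dual_of_gaps`);
  so `⨅_u tilt = inf_{X_{vim10}} F_{vim10}` (`iInf_tilt_eq_sInf_dualCell`);
* P2 g5's duality `inv_fSup_eq_sInf_dualCell` (`Families/BasicGrowthDuality`): `inf_{X_σ} F_σ = 1/M_{σ⁻¹}`, and the seating
  `vim10` is dihedrally SELF-DUAL (`vim10⁻¹ = ρ∘vim10∘ρ` for the reflection `ρ`; `fSup_vimInv`), so the infimum is `1/vimSup`;
* hence **`vimRate_eq : vimRate = −log vimSup`** and **`tendsto_log_A_div_neg_log_vimSup : log A(n)/n → −log vimSup`**, and with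
  cert-1 g5's `vimCharPoly_inv_vimSup`: **`tendsto_log_A_div_root`** — the growth exponent of the VIM leading coefficients is
  `log λ₄`, `λ₄ = 1/vimSup ∈ (6329.25, 6329.27)` the largest root of `χ(λ) = λ⁴ − 6340λ³ + 67974λ² − 6340λ + 1`, the
  characteristic polynomial of their PROVED recurrence (`Certificates/VIML3Holds`): growth of the leading coefficients =
  reciprocal of the decay of the integrals (fam-brown9's exact-anchored MODEL `b̂ = 8.7529` of the diagonal is now a theorem).
Standard axioms only.
-/

noncomputable section

open Finset Real Filter Topology

namespace Summit.KontsevichZagierPeriods.Zeta5Search.Families.Cellular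

namespace CubicalChartN


/-! ## The dual-cell Laurent polynomial as a real function and the tilt dictionary -/

/-- `Λ(g) = ∏_{chords} L_e(g) / ∏_{gaps} g_w` (frame gauge of `Families/CubicalChartVIM`). -/
def Lam (g : Fin 8 → ℝ) : ℝ :=
  (g 6 + g 7) * (g 0 + g 1 + g 2 + g 3 + g 4 + g 5) * (g 0 + g 1 + g 2 + g 3 + g 4 + g 5 + g 6) *
      (g 2 + g 3 + g 4 + g 5 + g 6) * (g 1 + g 2 + g 3) * (g 1 + g 2) * (g 3 + g 4) * (g 5 + g 6 + g 7) /
    (g 0 * g 1 * g 2 * g 3 * g 4 * g 5 * g 6 * g 7)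

/-- `P₁` evaluated at a real point is the numerator of `Λ`. -/
theorem eval_vimPolyR (g : Fin 8 → ℝ) : MvPolynomial.eval g vimPolyR =
    (g 6 + g 7) * (g 0 + g 1 + g 2 + g 3 + g 4 + g 5) * (g 0 + g 1 + g 2 + g 3 + g 4 + g 5 + g 6) *
      (g 2 + g 3 + g 4 + g 5 + g 6) * (g 1 + g 2 + g 3) * (g 1 + g 2) * (g 3 + g 4) * (g 5 + g 6 + g 7) := by
  rw [vimPolyR, MvPolynomial.eval_map, vimSpanProd]
  simp [MvPolynomial.eval₂_mul, MvPolynomial.eval₂_add, Cells.VanishingMiddleLeading.basic]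

/-- **Tilt dictionary**: `tilt(u) = Λ(e^u)`. -/
theorem tilt_eq_Lam (u : Fin 8 → ℝ) :
    CoeffAsymp.tilt vimPolyR.support (fun m => MvPolynomial.coeff m vimPolyR) onesGap u = Lam (fun i => exp (u i)) := by
  have hdot : ∀ α : Fin 8 →₀ ℕ, exp (CoeffAsymp.dot onesGap α u) = (∏ i, exp (u i) ^ (α i)) / ∏ i, exp (u i) := by
    intro α
    have hs : CoeffAsymp.dot onesGap α u = (∑ i, (α i : ℝ) * u i) - ∑ i, u i := by
      simp only [CoeffAsymp.dot, CoeffAsymp.dvec, onesGap, Finsupp.coe_equivFunOnFinite_symm, Nat.cast_one, sub_mul,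
        one_mul, Finset.sum_sub_distrib]
    rw [hs, Real.exp_sub, Real.exp_sum, Real.exp_sum]
    congr 1
    refine Finset.prod_congr rfl fun i _ => ?_
    rw [← Real.exp_nat_mul]
  unfold CoeffAsymp.tilt Lam
  simp_rw [hdot, mul_div_assoc']
  rw [← Finset.sum_div, ← MvPolynomial.eval_eq', eval_vimPolyR, Fin.prod_univ_eight]

/-! ## The Möbius identity: `F_{vim10}(z) = Λ(g(z))` on the dual cell -/

/-- The labels (0-based) of the nine finite points in the frame order `3,8,5,9,7,10,2,4,1` (the point `6`, label `5`, at ∞). -/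
def lab : Fin 9 → Fin 10 := ![2, 7, 4, 8, 6, 9, 1, 3, 0]

/-- The Möbius map sending `z 5` to infinity (orientation preserving on each side). -/
def psi (z : Fin 10 → ℝ) (x : ℝ) : ℝ := (z 5 - x)⁻¹

/-- The eight gaps of the Möbius image in the frame order. -/
def gapsOf (z : Fin 10 → ℝ) (w : Fin 8) : ℝ := psi z (z (lab w.succ)) - psi z (z (lab w.castSucc))

/-- The key abstract cancellation: sixteen differences of reciprocals against the two raw products. -/
theorem moebius_cancel (d01 d12 d32 d34 d67 d87 d98 d09 e72 e47 e84 e68 e96 e19 e31 e03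
    q0 q1 q2 q3 q4 q6 q7 q8 q9 : ℝ) (h0 : q0 ≠ 0) (h1 : q1 ≠ 0) (h2 : q2 ≠ 0) (h3 : q3 ≠ 0) (h4 : q4 ≠ 0)
    (h6 : q6 ≠ 0) (h7 : q7 ≠ 0) (h8 : q8 ≠ 0) (h9 : q9 ≠ 0) (g72 : e72 ≠ 0) (g47 : e47 ≠ 0) (g84 : e84 ≠ 0)
    (g68 : e68 ≠ 0) (g96 : e96 ≠ 0) (g19 : e19 ≠ 0) (g31 : e31 ≠ 0) (g03 : e03 ≠ 0) :
    d01 / (q0 * q1) * (d12 / (q1 * q2)) * (d32 / (q3 * q2)) * (d34 / (q3 * q4)) * (d67 / (q6 * q7)) *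
        (d87 / (q8 * q7)) * (d98 / (q9 * q8)) * (d09 / (q0 * q9)) /
      (e72 / (q7 * q2) * (e47 / (q4 * q7)) * (e84 / (q8 * q4)) * (e68 / (q6 * q8)) * (e96 / (q9 * q6)) *
        (e19 / (q1 * q9)) * (e31 / (q3 * q1)) * (e03 / (q0 * q3))) =
      d01 * d12 * d32 * d34 * d67 * d87 * d98 * d09 * q4 * q6 / (e72 * e47 * e84 * e68 * e96 * e19 * e31 * e03 * q0 * q2) := by
  simp only [div_mul_div_comm]
  rw [div_div_div_eq, div_eq_div_iff]
  · ring
  · apply mul_ne_zero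
    · apply_rules [mul_ne_zero]
    · apply_rules [mul_ne_zero]
  · apply_rules [mul_ne_zero]

/-- A difference of the Möbius images: `ψ(a) − ψ(b) = (a − b)/((z₅ − a)(z₅ − b))`. -/
theorem psi_sub (z : Fin 10 → ℝ) {a b : ℝ} (ha : z 5 - a ≠ 0) (hb : z 5 - b ≠ 0) :
    psi z a - psi z b = (a - b) / ((z 5 - a) * (z 5 - b)) := by
  unfold psi
  field_simp
  ring

/-- The order of the dual cell, unfolded: `z₉ < z₁ < z₃ < z₀ < z₅ < z₂ < z₇ < z₄ < z₈ < z₆`. -/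
theorem dual_order {z : Fin 10 → ℝ} (hz : StrictMono (z ∘ vim10)) :
    z 9 < z 1 ∧ z 1 < z 3 ∧ z 3 < z 0 ∧ z 0 < z 5 ∧ z 5 < z 2 ∧ z 2 < z 7 ∧ z 7 < z 4 ∧ z 4 < z 8 ∧ z 8 < z 6 := by
  have h := fun (i j : Fin 10) (hij : i < j) => hz hij
  refine ⟨h 0 1 (by decide), h 1 2 (by decide), h 2 3 (by decide), h 3 4 (by decide), h 4 5 (by decide),
    h 5 6 (by decide), h 6 7 (by decide), h 7 8 (by decide), h 8 9 (by decide)⟩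

/-- `Λ > 0` on positive gap vectors. -/
theorem Lam_pos {g : Fin 8 → ℝ} (h : ∀ w, 0 < g w) : 0 < Lam g := by
  unfold Lam
  have := h 0; have := h 1; have := h 2; have := h 3; have := h 4; have := h 5; have := h 6; have := h 7
  positivity

/-- The eight Möbius gaps, unfolded. -/
theorem gapsOf_eq (z : Fin 10 → ℝ) : gapsOf z 0 = psi z (z 7) - psi z (z 2) ∧ gapsOf z 1 = psi z (z 4) - psi z (z 7) ∧
    gapsOf z 2 = psi z (z 8) - psi z (z 4) ∧ gapsOf z 3 = psi z (z 6) - psi z (z 8) ∧ gapsOf z 4 = psi z (z 9) - psi z (z 6) ∧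
    gapsOf z 5 = psi z (z 1) - psi z (z 9) ∧ gapsOf z 6 = psi z (z 3) - psi z (z 1) ∧ gapsOf z 7 = psi z (z 0) - psi z (z 3) := by
  simp only [gapsOf, lab, Fin.succ_zero_eq_one, Fin.succ_one_eq_two, Fin.castSucc_zero, Fin.castSucc_one,
      show (2 : Fin 8).succ = 3 from rfl, show (3 : Fin 8).succ = 4 from rfl, show (4 : Fin 8).succ = 5 from rfl,
      show (5 : Fin 8).succ = 6 from rfl, show (6 : Fin 8).succ = 7 from rfl, show (7 : Fin 8).succ = 8 from rfl,
      show (2 : Fin 8).castSucc = 2 from rfl, show (3 : Fin 8).castSucc = 3 from rfl, show (4 : Fin 8).castSucc = 4 from rfl,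
      show (5 : Fin 8).castSucc = 5 from rfl, show (6 : Fin 8).castSucc = 6 from rfl, show (7 : Fin 8).castSucc = 7 from rfl,
      Matrix.cons_val_zero, Matrix.cons_val_one, Matrix.cons_val, Fin.isValue, and_self]

/-- On the dual cell the Möbius gaps are positive. -/
theorem gapsOf_pos {z : Fin 10 → ℝ} (hz : StrictMono (z ∘ vim10)) (w : Fin 8) : 0 < gapsOf z w := by
  obtain ⟨h91, h13, h30, h05, h52, h27, h74, h48, h86⟩ := dual_order hz
  obtain ⟨e0, e1, e2, e3, e4, e5, e6, e7⟩ := gapsOf_eq z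
  have q0 : z 5 - z 0 ≠ 0 := by linarith
  have q1 : z 5 - z 1 ≠ 0 := by linarith
  have q2 : z 5 - z 2 ≠ 0 := by linarith
  have q3 : z 5 - z 3 ≠ 0 := by linarith
  have q4 : z 5 - z 4 ≠ 0 := by linarith
  have q6 : z 5 - z 6 ≠ 0 := by linarith
  have q7 : z 5 - z 7 ≠ 0 := by linarith
  have q8 : z 5 - z 8 ≠ 0 := by linarith
  have q9 : z 5 - z 9 ≠ 0 := by linarith
  have g0 : 0 < gapsOf z 0 := by
    rw [e0, psi_sub z q7 q2]; exact div_pos (by linarith) (mul_pos_of_neg_of_neg (by linarith) (by linarith))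
  have g1 : 0 < gapsOf z 1 := by
    rw [e1, psi_sub z q4 q7]; exact div_pos (by linarith) (mul_pos_of_neg_of_neg (by linarith) (by linarith))
  have g2 : 0 < gapsOf z 2 := by
    rw [e2, psi_sub z q8 q4]; exact div_pos (by linarith) (mul_pos_of_neg_of_neg (by linarith) (by linarith))
  have g3 : 0 < gapsOf z 3 := by
    rw [e3, psi_sub z q6 q8]; exact div_pos (by linarith) (mul_pos_of_neg_of_neg (by linarith) (by linarith))
  have g4 : 0 < gapsOf z 4 := by
    rw [e4, psi_sub z q9 q6]; exact div_pos_of_neg_of_neg (by linarith) (mul_neg_of_pos_of_neg (by linarith) (by linarith))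
  have g5 : 0 < gapsOf z 5 := by
    rw [e5, psi_sub z q1 q9]; exact div_pos (by linarith) (mul_pos (by linarith) (by linarith))
  have g6 : 0 < gapsOf z 6 := by
    rw [e6, psi_sub z q3 q1]; exact div_pos (by linarith) (mul_pos (by linarith) (by linarith))
  have g7 : 0 < gapsOf z 7 := by
    rw [e7, psi_sub z q0 q3]; exact div_pos (by linarith) (mul_pos (by linarith) (by linarith))
  fin_cases w
  exacts [g0, g1, g2, g3, g4, g5, g6, g7]

/-- **`F_{vim10}(z) = Λ(g(z))`** on the dual cell. -/
theorem FSigma_eq_Lam {z : Fin 10 → ℝ} (hz : StrictMono (z ∘ vim10)) : FSigma vim10 z = Lam (gapsOf z) := by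
  obtain ⟨h91, h13, h30, h05, h52, h27, h74, h48, h86⟩ := dual_order hz
  have q0 : z 5 - z 0 ≠ 0 := by linarith
  have q1 : z 5 - z 1 ≠ 0 := by linarith
  have q2 : z 5 - z 2 ≠ 0 := by linarith
  have q3 : z 5 - z 3 ≠ 0 := by linarith
  have q4 : z 5 - z 4 ≠ 0 := by linarith
  have q6 : z 5 - z 6 ≠ 0 := by linarith
  have q7 : z 5 - z 7 ≠ 0 := by linarith
  have q8 : z 5 - z 8 ≠ 0 := by linarith
  have q9 : z 5 - z 9 ≠ 0 := by linarith
  -- the raw products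
  have hN : ∏ i : Fin 10, (z i - z (i + 1)) =
      -(((z 0 - z 1) * (z 1 - z 2) * (z 3 - z 2) * (z 3 - z 4) * (z 6 - z 7) * (z 8 - z 7) * (z 9 - z 8) * (z 0 - z 9)) *
        (z 5 - z 4) * (z 5 - z 6)) := by
    simp only [Fin.prod_univ_succ, Fin.prod_univ_zero, mul_one, Fin.isValue, Fin.succ_zero_eq_one, Fin.succ_one_eq_two,
      Fin.reduceAdd, Fin.reduceSucc]
    ring
  have hD : ∏ i : Fin 10, (z (vim10 i) - z (vim10 (i + 1))) =
      -(((z 7 - z 2) * (z 4 - z 7) * (z 8 - z 4) * (z 6 - z 8) * (z 9 - z 6) * (z 1 - z 9) * (z 3 - z 1) * (z 0 - z 3)) *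
        (z 5 - z 0) * (z 5 - z 2)) := by
    simp only [Fin.prod_univ_succ, Fin.prod_univ_zero, mul_one, Fin.isValue, Fin.succ_zero_eq_one, Fin.succ_one_eq_two,
      Fin.reduceAdd, Fin.reduceSucc, vim10, Matrix.cons_val_zero, Matrix.cons_val_one, Matrix.cons_val]
    ring
  -- the Möbius side, telescoped
  have hL1 : Lam (gapsOf z) =
      (psi z (z 0) - psi z (z 1)) * (psi z (z 1) - psi z (z 2)) * (psi z (z 3) - psi z (z 2)) * (psi z (z 3) - psi z (z 4)) *
          (psi z (z 6) - psi z (z 7)) * (psi z (z 8) - psi z (z 7)) * (psi z (z 9) - psi z (z 8)) * (psi z (z 0) - psi z (z 9)) /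
        ((psi z (z 7) - psi z (z 2)) * (psi z (z 4) - psi z (z 7)) * (psi z (z 8) - psi z (z 4)) * (psi z (z 6) - psi z (z 8)) *
          (psi z (z 9) - psi z (z 6)) * (psi z (z 1) - psi z (z 9)) * (psi z (z 3) - psi z (z 1)) * (psi z (z 0) - psi z (z 3))) := by
    obtain ⟨e0, e1, e2, e3, e4, e5, e6, e7⟩ := gapsOf_eq z
    unfold Lam
    rw [e0, e1, e2, e3, e4, e5, e6, e7]
    simp only [sub_add_sub_cancel']
  have n72 : z 7 - z 2 ≠ 0 := (sub_pos.2 h27).ne'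
  have n47 : z 4 - z 7 ≠ 0 := (sub_pos.2 h74).ne'
  have n84 : z 8 - z 4 ≠ 0 := (sub_pos.2 h48).ne'
  have n68 : z 6 - z 8 ≠ 0 := (sub_pos.2 h86).ne'
  have n96 : z 9 - z 6 ≠ 0 := (sub_neg.2 (by linarith : z 9 < z 6)).ne
  have n19 : z 1 - z 9 ≠ 0 := (sub_pos.2 h91).ne'
  have n31 : z 3 - z 1 ≠ 0 := (sub_pos.2 h13).ne'
  have n03 : z 0 - z 3 ≠ 0 := (sub_pos.2 h30).ne'
  have hL : Lam (gapsOf z) =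
      (z 0 - z 1) * (z 1 - z 2) * (z 3 - z 2) * (z 3 - z 4) * (z 6 - z 7) * (z 8 - z 7) * (z 9 - z 8) * (z 0 - z 9) *
          (z 5 - z 4) * (z 5 - z 6) /
        ((z 7 - z 2) * (z 4 - z 7) * (z 8 - z 4) * (z 6 - z 8) * (z 9 - z 6) * (z 1 - z 9) * (z 3 - z 1) * (z 0 - z 3) *
          (z 5 - z 0) * (z 5 - z 2)) := by
    rw [hL1, psi_sub z q0 q1, psi_sub z q1 q2, psi_sub z q3 q2, psi_sub z q3 q4, psi_sub z q6 q7, psi_sub z q8 q7,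
      psi_sub z q9 q8, psi_sub z q0 q9, psi_sub z q7 q2, psi_sub z q4 q7, psi_sub z q8 q4, psi_sub z q6 q8, psi_sub z q9 q6,
      psi_sub z q1 q9, psi_sub z q3 q1, psi_sub z q0 q3]
    exact moebius_cancel _ _ _ _ _ _ _ _ _ _ _ _ _ _ _ _ _ _ _ _ _ _ _ _ _ q0 q1 q2 q3 q4 q6 q7 q8 q9
      n72 n47 n84 n68 n96 n19 n31 n03
  have hpos : 0 < Lam (gapsOf z) := Lam_pos (gapsOf_pos hz)
  unfold FSigma
  rw [hN, hD, ← abs_div, neg_div_neg_eq, ← hL, abs_of_pos hpos]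

/-! ## Every positive gap vector is realised: the inverse construction -/

/-- A configuration of the dual cell with prescribed Möbius gaps `g`: partial sums `p_k`, a cut `c` between `p₄` and `p₅`,
`z_{lab k} = 1/(c − p_k)`, `z₅ = 0`. -/
def zOfGaps (g : Fin 8 → ℝ) : Fin 10 → ℝ :=
  let p0 : ℝ := 0
  let p1 := g 0
  let p2 := g 0 + g 1
  let p3 := g 0 + g 1 + g 2
  let p4 := g 0 + g 1 + g 2 + g 3
  let p5 := g 0 + g 1 + g 2 + g 3 + g 4
  let p6 := g 0 + g 1 + g 2 + g 3 + g 4 + g 5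
  let p7 := g 0 + g 1 + g 2 + g 3 + g 4 + g 5 + g 6
  let p8 := g 0 + g 1 + g 2 + g 3 + g 4 + g 5 + g 6 + g 7
  let c := g 0 + g 1 + g 2 + g 3 + g 4 / 2
  ![(c - p8)⁻¹, (c - p6)⁻¹, (c - p0)⁻¹, (c - p7)⁻¹, (c - p2)⁻¹, 0, (c - p4)⁻¹, (c - p1)⁻¹, (c - p3)⁻¹, (c - p5)⁻¹]

/-- The construction, read in the order `vim10`. -/
theorem zOfGaps_comp (g : Fin 8 → ℝ) :
    let c := g 0 + g 1 + g 2 + g 3 + g 4 / 2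
    (zOfGaps g ∘ vim10) 0 = (c - (g 0 + g 1 + g 2 + g 3 + g 4))⁻¹ ∧
    (zOfGaps g ∘ vim10) 1 = (c - (g 0 + g 1 + g 2 + g 3 + g 4 + g 5))⁻¹ ∧
    (zOfGaps g ∘ vim10) 2 = (c - (g 0 + g 1 + g 2 + g 3 + g 4 + g 5 + g 6))⁻¹ ∧
    (zOfGaps g ∘ vim10) 3 = (c - (g 0 + g 1 + g 2 + g 3 + g 4 + g 5 + g 6 + g 7))⁻¹ ∧
    (zOfGaps g ∘ vim10) 4 = 0 ∧
    (zOfGaps g ∘ vim10) 5 = (c - 0)⁻¹ ∧ (zOfGaps g ∘ vim10) 6 = (c - g 0)⁻¹ ∧ (zOfGaps g ∘ vim10) 7 = (c - (g 0 + g 1))⁻¹ ∧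
    (zOfGaps g ∘ vim10) 8 = (c - (g 0 + g 1 + g 2))⁻¹ ∧ (zOfGaps g ∘ vim10) 9 = (c - (g 0 + g 1 + g 2 + g 3))⁻¹ := by
  simp only [Function.comp_apply, zOfGaps, vim10, Matrix.cons_val_zero, Matrix.cons_val_one, Matrix.cons_val, Fin.isValue,
    and_self]

/-- The construction lies in the dual cell. -/
theorem strictMono_zOfGaps {g : Fin 8 → ℝ} (h : ∀ w, 0 < g w) : StrictMono (zOfGaps g ∘ vim10) := by
  have h0 := h 0; have h1 := h 1; have h2 := h 2; have h3 := h 3; have h4 := h 4; have h5 := h 5; have h6 := h 6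
  have h7 := h 7
  obtain ⟨e0, e1, e2, e3, e4, e5, e6, e7, e8, e9⟩ := zOfGaps_comp g
  have s0 : (zOfGaps g ∘ vim10) 0 < (zOfGaps g ∘ vim10) 1 := by
    rw [e0, e1]; exact (inv_lt_inv_of_neg (by linarith) (by linarith)).2 (by linarith)
  have s1 : (zOfGaps g ∘ vim10) 1 < (zOfGaps g ∘ vim10) 2 := by
    rw [e1, e2]; exact (inv_lt_inv_of_neg (by linarith) (by linarith)).2 (by linarith)
  have s2 : (zOfGaps g ∘ vim10) 2 < (zOfGaps g ∘ vim10) 3 := by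
    rw [e2, e3]; exact (inv_lt_inv_of_neg (by linarith) (by linarith)).2 (by linarith)
  have s3 : (zOfGaps g ∘ vim10) 3 < (zOfGaps g ∘ vim10) 4 := by
    rw [e3, e4]; exact inv_lt_zero.2 (by linarith)
  have s4 : (zOfGaps g ∘ vim10) 4 < (zOfGaps g ∘ vim10) 5 := by
    rw [e4, e5]; exact inv_pos.2 (by linarith)
  have s5 : (zOfGaps g ∘ vim10) 5 < (zOfGaps g ∘ vim10) 6 := by
    rw [e5, e6]; exact (inv_lt_inv₀ (by linarith) (by linarith)).2 (by linarith)
  have s6 : (zOfGaps g ∘ vim10) 6 < (zOfGaps g ∘ vim10) 7 := by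
    rw [e6, e7]; exact (inv_lt_inv₀ (by linarith) (by linarith)).2 (by linarith)
  have s7 : (zOfGaps g ∘ vim10) 7 < (zOfGaps g ∘ vim10) 8 := by
    rw [e7, e8]; exact (inv_lt_inv₀ (by linarith) (by linarith)).2 (by linarith)
  have s8 : (zOfGaps g ∘ vim10) 8 < (zOfGaps g ∘ vim10) 9 := by
    rw [e8, e9]; exact (inv_lt_inv₀ (by linarith) (by linarith)).2 (by linarith)
  rw [Fin.strictMono_iff_lt_succ]
  intro i
  fin_cases i
  exacts [s0, s1, s2, s3, s4, s5, s6, s7, s8]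

/-- The construction has the prescribed gaps. -/
theorem gapsOf_zOfGaps (g : Fin 8 → ℝ) : gapsOf (zOfGaps g) = g := by
  obtain ⟨e0, e1, e2, e3, e4, e5, e6, e7⟩ := gapsOf_eq (zOfGaps g)
  have hpsi : ∀ x, psi (zOfGaps g) x = -x⁻¹ := by
    intro x
    simp only [psi, zOfGaps, Matrix.cons_val, Fin.isValue, zero_sub, inv_neg]
  simp only [hpsi] at e0 e1 e2 e3 e4 e5 e6 e7
  have v : ∀ k : Fin 10, zOfGaps g k = ![(g 0 + g 1 + g 2 + g 3 + g 4 / 2 - (g 0 + g 1 + g 2 + g 3 + g 4 + g 5 + g 6 + g 7))⁻¹,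
      (g 0 + g 1 + g 2 + g 3 + g 4 / 2 - (g 0 + g 1 + g 2 + g 3 + g 4 + g 5))⁻¹, (g 0 + g 1 + g 2 + g 3 + g 4 / 2 - 0)⁻¹,
      (g 0 + g 1 + g 2 + g 3 + g 4 / 2 - (g 0 + g 1 + g 2 + g 3 + g 4 + g 5 + g 6))⁻¹,
      (g 0 + g 1 + g 2 + g 3 + g 4 / 2 - (g 0 + g 1))⁻¹, 0, (g 0 + g 1 + g 2 + g 3 + g 4 / 2 - (g 0 + g 1 + g 2 + g 3))⁻¹,
      (g 0 + g 1 + g 2 + g 3 + g 4 / 2 - g 0)⁻¹, (g 0 + g 1 + g 2 + g 3 + g 4 / 2 - (g 0 + g 1 + g 2))⁻¹,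
      (g 0 + g 1 + g 2 + g 3 + g 4 / 2 - (g 0 + g 1 + g 2 + g 3 + g 4))⁻¹] k := fun k => rfl
  funext w
  fin_cases w
  · show gapsOf (zOfGaps g) 0 = g 0
    rw [e0, v 7, v 2]; simp only [Matrix.cons_val, inv_inv]; ring
  · show gapsOf (zOfGaps g) 1 = g 1
    rw [e1, v 4, v 7]; simp only [Matrix.cons_val, inv_inv]; ring
  · show gapsOf (zOfGaps g) 2 = g 2
    rw [e2, v 8, v 4]; simp only [Matrix.cons_val, inv_inv]; ring
  · show gapsOf (zOfGaps g) 3 = g 3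
    rw [e3, v 6, v 8]; simp only [Matrix.cons_val, inv_inv]; ring
  · show gapsOf (zOfGaps g) 4 = g 4
    rw [e4, v 9, v 6]; simp only [Matrix.cons_val, inv_inv]; ring
  · show gapsOf (zOfGaps g) 5 = g 5
    rw [e5, v 1, v 9]; simp only [Matrix.cons_val, Matrix.cons_val_one, inv_inv]; ring
  · show gapsOf (zOfGaps g) 6 = g 6
    rw [e6, v 3, v 1]; simp only [Matrix.cons_val, Matrix.cons_val_one, inv_inv]; ring
  · show gapsOf (zOfGaps g) 7 = g 7
    rw [e7, v 0, v 3]; simp only [Matrix.cons_val, Matrix.cons_val_zero, inv_inv]; ring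

/-! ## The infimum over `u` is the infimum of `F_{vim10}` over the dual cell -/

/-- The values of the tilt are exactly the values of `F_{vim10}` on the dual cell. -/
theorem range_tilt_eq :
    Set.range (fun u : Fin 8 → ℝ => CoeffAsymp.tilt vimPolyR.support (fun m => MvPolynomial.coeff m vimPolyR) onesGap u) =
      FSigma vim10 '' {z : Fin 10 → ℝ | StrictMono (z ∘ vim10)} := by
  ext v
  constructor
  · rintro ⟨u, rfl⟩
    have hg : ∀ w, 0 < Real.exp (u w) := fun w => Real.exp_pos _
    refine ⟨zOfGaps (fun w => Real.exp (u w)), strictMono_zOfGaps hg, ?_⟩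
    beta_reduce
    rw [FSigma_eq_Lam (strictMono_zOfGaps hg), gapsOf_zOfGaps, tilt_eq_Lam]
  · rintro ⟨z, hz, rfl⟩
    refine ⟨fun w => Real.log (gapsOf z w), ?_⟩
    simp only [tilt_eq_Lam]
    rw [FSigma_eq_Lam hz]
    congr 1
    funext w
    exact Real.exp_log (gapsOf_pos hz w)

/-- **`⨅_u tilt(u) = inf_{X_{vim10}} F_{vim10}`.** -/
theorem iInf_tilt_eq_sInf_dualCell :
    (⨅ u : Fin 8 → ℝ, CoeffAsymp.tilt vimPolyR.support (fun m => MvPolynomial.coeff m vimPolyR) onesGap u) =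
      sInf (FSigma vim10 '' {z : Fin 10 → ℝ | StrictMono (z ∘ vim10)}) := by
  rw [iInf, range_tilt_eq]

/-! ## Self-duality of the seating and the identification -/

/-- The inverse seating `vim10⁻¹ = (3,1,5,2,7,4,9,6,8,0)` (0-based). -/
def vimInv : Fin 10 → Fin 10 := ![3, 1, 5, 2, 7, 4, 9, 6, 8, 0]

/-- `vim10 ∘ vim10⁻¹ = id`. -/
theorem vim10_vimInv : ∀ i, vim10 (vimInv i) = i := by decide

/-- `vim10⁻¹ ∘ vim10 = id`. -/
theorem vimInv_vim10 : ∀ i, vimInv (vim10 i) = i := by decide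

/-- **Self-duality**: `vim10⁻¹` is dihedrally equivalent to `vim10` (reverse the positions and reflect the labels), so the two
growth constants agree. -/
theorem fSup_vimInv : fSup vimInv = fSup vim10 := by
  have h1 : vimInv = ofSeating (ℓ := 7) [4, 2, 6, 3, 8, 5, 10, 7, 9, 1] := by decide
  rw [h1, vim10_eq_ofSeating]
  exact fSup_ofSeating_eq_of_equivalent (by decide) (by decide) (by decide)

/-- **`⨅_u tilt(u) = 1/vimSup`.** -/
theorem iInf_tilt_eq_inv_vimSup :
    (⨅ u : Fin 8 → ℝ, CoeffAsymp.tilt vimPolyR.support (fun m => MvPolynomial.coeff m vimPolyR) onesGap u) = vimSup⁻¹ := by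
  rw [iInf_tilt_eq_sInf_dualCell, ← inv_fSup_eq_sInf_dualCell vim10_vimInv vimInv_vim10, fSup_vimInv]
  rfl

/-- **`vimRate = −log vimSup`**: the growth exponent of the leading coefficients is minus the decay exponent of the integrals. -/
theorem vimRate_eq : vimRate = -Real.log vimSup := by
  unfold vimRate
  rw [iInf_tilt_eq_inv_vimSup, Real.log_inv]

/-- **`log A(n)/n → −log vimSup`.** -/
theorem tendsto_log_A_div_neg_log_vimSup :
    Tendsto (fun n : ℕ => Real.log (CellularVIMRecurrenceLaws.A n : ℝ) / n) atTop (𝓝 (-Real.log vimSup)) := by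
  rw [← vimRate_eq]
  exact tendsto_log_A_div

/-- **The growth exponent of the VIM leading coefficients is `log λ₄`**, `λ₄ = 1/vimSup ∈ (6329.25, 6329.27)` the largest root
of `χ(λ) = λ⁴ − 6340λ³ + 67974λ² − 6340λ + 1` (cert-1 g5 `vimCharPoly_inv_vimSup`). -/
theorem tendsto_log_A_div_root : ∃ lam : ℝ, vimCharPoly lam = 0 ∧ (632925 : ℝ) / 100 < lam ∧ lam < (632927 : ℝ) / 100 ∧
    Tendsto (fun n : ℕ => Real.log (CellularVIMRecurrenceLaws.A n : ℝ) / n) atTop (𝓝 (Real.log lam)) := by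
  obtain ⟨hχ, hlo, hhi⟩ := vimCharPoly_inv_vimSup
  refine ⟨1 / vimSup, hχ, hlo, hhi, ?_⟩
  rw [one_div, Real.log_inv]
  exact tendsto_log_A_div_neg_log_vimSup

end CubicalChartN

end Summit.KontsevichZagierPeriods.Zeta5Search.Families.Cellular
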